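import Mathlib
import Summits.KontsevichZagierPeriods.Zeta5Search.Ray5Points
import Summits.KontsevichZagierPeriods.Zeta5Search.CellKitCentre
import Summits.KontsevichZagierPeriods.Zeta5Search.Ray5Z13P1
import Summits.KontsevichZagierPeriods.Zeta5Search.Ray5O12P1
import HarnessLib

/-!
# ζ(5) search — T1-map ray `bRay β5 n`: origin window `M = 8` (`23 * n < 2 * p`, `p ≤ 12 * n`): `T1Rays.Ray5OriginClassesO12` (part 2/2)

HONEST FRAMING: systematic search; no irrationality claim unless certified.

Cell `pub-zeta5`, GEN-2 seat generation 16, with p3 g3's window machine (`code/gen/zwgen.py`; gen-2 g16 fork `pub-zeta5-gen-2/g16/t1gen` for general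
(non-AP) rays `bRay β n`, point facts from the ray point kit `T1Rays.Ray5Points`) in the format of typer g14's `Ray4OriginM8*`: exact scale-free
class analysis of the ray `b(n) = n·(51; 21 19 18 16 15 13 12)` on the window `23 * n < 2 * p` and `p ≤ 12 * n`
(all odd `p` and all `n ≤ 300`: 11250 instances; class lengths `4 5`; bracket signatures per length
`4:9 5:10`); every statement then PROVED (`omega` leaf by leaf; one LEAF theorem per signature;
decision tree inline in `zw_L*`).  Target: gen-2 g16's `@[conjecture]` node `T1Rays.Ray5OriginClassesO12`
(`OriginWindowClasses (bRay β5 n) p 8 …`: deep types `D8`; centre-free sub-deep `S8`; odd-centre `Pc8`) and hence the window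
bound `T1Rays.Ray5WindowO12` (-11) by gen-2 g16's PROVED reduction `T1Rays.ray5WindowO12_of`.
The ray-layer lemmas `Ray5Z13.classExp_L3`, `Ray5Z13.classExp_L4` are reused BY NAME from the sibling zero window (no restatement).
Integer bookkeeping (`netExp` along residue classes); valuations of rationals; nothing here bears on irrationality.
-/

open Finset

namespace Summit.KontsevichZagierPeriods.Zeta5Search.Ray5O12

open Summit.KontsevichZagierPeriods.Zeta5Search.ClusterValuation (netExp classSet CentreIn classExp conjClass classPoleCount)
open Summit.KontsevichZagierPeriods.Zeta5Search.CasoratianValuation (InPolytope shift casoratian)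
open Summit.KontsevichZagierPeriods.Zeta5Search.CellKit
open Summit.KontsevichZagierPeriods.Zeta5Search.SecondOrder (classTypeList isRaise classTypeList_level)
open Summit.KontsevichZagierPeriods.Zeta5Search.OriginWindows (OriginWindowClasses)
open Summit.KontsevichZagierPeriods.Zeta5Search.Ray4Windows (D8 S8)
open Summit.KontsevichZagierPeriods.Zeta5Search.T1Rays
open Summit.KontsevichZagierPeriods.Zeta5Search.T1Rays.Ray5Points

variable {p : ℕ} [hp : Fact p.Prime]

set_option maxHeartbeats 800000 in
/-- **Zero-window structure of the classes of `4` points** (`M = 8`): exponent `≥ −8`; the `−8` classes are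
centre-free of a type in `D8`; the `−7` classes are raises / odd-centre satellites of `D8` or centre-free members
of the extra pair `S8` (directly or through the conjugate class). -/
theorem zw_L3 {n x : ℕ} (h1 : 23 * n < 2 * p) (h2 : p ≤ 12 * n) (hp2 : p % 2 = 1) (hx : x < p)
    (hL : x + 3 * p ≤ 51 * n) (hL' : 51 * n < x + 3 * p + p) :
    (-8 : ℤ) ≤ classExp (bRay β5 n) p x ∧
    (classExp (bRay β5 n) p x = -8 → ¬ CentreIn (bRay β5 n) p x ∧ classTypeList (bRay β5 n) p x ∈ D8) ∧
    (classExp (bRay β5 n) p x = -7 →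
      (¬ CentreIn (bRay β5 n) p x ∧ classTypeList (bRay β5 n) p x ∈ S8) ∨
      (¬ (2 : ℤ) ∣ (bRay β5 n) 0 ∧ CentreIn (bRay β5 n) p x ∧ classTypeList (bRay β5 n) p x ∈ Pc8)) := by
  have hE' := Ray5Z13.classExp_L3 (p := p) (n := n) (x := x) hx hL hL'
  have hT := centreTerm_spec (bRay β5 n) p x
  generalize hcT : (if ¬ (2 : ℤ) ∣ (bRay β5 n) 0 ∧ CentreIn (bRay β5 n) p x then (1 : ℤ) else 0) = cT at hE' hT
  have h0 : (0 : ℤ) ≤ (bRay β5 n) 0 := by rw [ray5_zero]; positivity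
  have hL1 : x + 3 * p ≤ ((bRay β5 n) 0).toNat := by rw [b0_toNat]; exact hL
  have hL2 : ((bRay β5 n) 0).toNat < x + 3 * p + p := by rw [b0_toNat]; exact hL'
  have hcen : CentreIn (bRay β5 n) p x ↔ 2 * x + 3 * p = 51 * n := by
    rw [centreIn_iff_last (bRay β5 n) (L := 3) hx hL1 hL2 h0, b0_toNat]
  have hb0 : (bRay β5 n) 0 = ((51 * n : ℕ) : ℤ) := ray5_zero n
  rw [hcen, hb0] at hT
  have hTL : classTypeList (bRay β5 n) p x = [netExp (bRay β5 n) (x), netExp (bRay β5 n) (x + p), netExp (bRay β5 n) (x + 2 * p),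
      netExp (bRay β5 n) (x + 3 * p)] := by
    rw [classTypeList_level (bRay β5 n) hL1 hL2, show List.range (3 + 1) = [0, 1, 2, 3] from rfl]
    simp only [List.map_cons, List.map_nil, zero_mul, add_zero, one_mul]
  by_cases ht1 : x + p < 19 * n
  · by_cases ht2 : x + p < 18 * n
    · by_cases ht3 : x + p < 16 * n
      · obtain ⟨c1, c2, c3, c4, c5, c6, c7, e0, e1, e2, e3⟩ :=
          leaf_L3_1 h1 h2 hp2 hx hL hL' ht1 ht2 ht3
        simp only [e0, e1, e2, e3] at hTL
        exact ⟨by omega, fun hE => absurd hE (by omega), fun hE => absurd hE (by omega)⟩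
      · obtain ⟨c1, c2, c3, c4, c5, c6, c7, e0, e1, e2, e3⟩ :=
          leaf_L3_2 h1 h2 hp2 hx hL hL' ht1 ht2 ht3
        simp only [e0, e1, e2, e3] at hTL
        refine ⟨by omega, fun hE => absurd hE (by omega), fun hE => ?_⟩
        exact Or.inl ⟨fun hc => by have hc' := hcen.1 hc; omega, by rw [hTL]; decide⟩
    · by_cases ht3 : x + 2 * p ≤ 30 * n
      · obtain ⟨c1, c2, c3, c4, c5, c6, c7, e0, e1, e2, e3⟩ :=
          leaf_L3_4 h1 h2 hp2 hx hL hL' ht1 ht2 ht3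
        simp only [e0, e1, e2, e3] at hTL
        refine ⟨by omega, fun hE => ⟨fun hc => by have hc' := hcen.1 hc; omega, by rw [hTL]; decide⟩, fun hE => ?_⟩
        exfalso; omega
      · obtain ⟨c1, c2, c3, c4, c5, c6, e0, e1, e2, e3⟩ :=
          leaf_L3_3 h1 h2 hp2 hx hL hL' ht1 ht2 ht3
        simp only [e0, e1, e2, e3] at hTL
        refine ⟨by omega, fun hE => absurd hE (by omega), fun hE => ?_⟩
        exact Or.inl ⟨fun hc => by have hc' := hcen.1 hc; omega, by rw [hTL]; decide⟩
  · by_cases ht2 : x + p < 21 * n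
    · by_cases ht3 : x + 2 * p ≤ 32 * n
      · obtain ⟨c1, c2, c3, c4, c5, c6, e0, e1, e2, e3⟩ :=
          leaf_L3_6 h1 h2 hp2 hx hL hL' ht1 ht2 ht3
        simp only [e0, e1, e2, e3] at hTL
        refine ⟨by omega, fun hE => ⟨fun hc => by have hc' := hcen.1 hc; omega, by rw [hTL]; decide⟩, fun hE => ?_⟩
        exact Or.inr ⟨by omega, hcen.2 (by omega), by rw [hTL]; decide⟩
      · obtain ⟨c1, c2, c3, c4, c5, c6, e0, e1, e2, e3⟩ :=
          leaf_L3_5 h1 h2 hp2 hx hL hL' ht1 ht2 ht3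
        simp only [e0, e1, e2, e3] at hTL
        refine ⟨by omega, fun hE => absurd hE (by omega), fun hE => ?_⟩
        exact Or.inl ⟨fun hc => by have hc' := hcen.1 hc; omega, by rw [hTL]; decide⟩
    · by_cases ht3 : x + 2 * p ≤ 33 * n
      · obtain ⟨c1, c2, c3, c4, c5, c6, c7, e0, e1, e2, e3⟩ :=
          leaf_L3_9 h1 h2 hp2 hx hL hL' ht1 ht2 ht3
        simp only [e0, e1, e2, e3] at hTL
        refine ⟨by omega, fun hE => ⟨fun hc => by have hc' := hcen.1 hc; omega, by rw [hTL]; decide⟩, fun hE => ?_⟩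
        exfalso; omega
      · by_cases ht4 : x + 2 * p ≤ 35 * n
        · obtain ⟨c1, c2, c3, c4, c5, c6, c7, e0, e1, e2, e3⟩ :=
            leaf_L3_8 h1 h2 hp2 hx hL hL' ht1 ht2 ht3 ht4
          simp only [e0, e1, e2, e3] at hTL
          refine ⟨by omega, fun hE => absurd hE (by omega), fun hE => ?_⟩
          exact Or.inl ⟨fun hc => by have hc' := hcen.1 hc; omega, by rw [hTL]; decide⟩
        · obtain ⟨c1, c2, c3, c4, c5, c6, c7, e0, e1, e2, e3⟩ :=
            leaf_L3_7 h1 h2 hp2 hx hL hL' ht1 ht2 ht3 ht4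
          simp only [e0, e1, e2, e3] at hTL
          exact ⟨by omega, fun hE => absurd hE (by omega), fun hE => absurd hE (by omega)⟩

set_option maxHeartbeats 800000 in
/-- **Zero-window structure of the classes of `5` points** (`M = 8`): exponent `≥ −8`; the `−8` classes are
centre-free of a type in `D8`; the `−7` classes are raises / odd-centre satellites of `D8` or centre-free members
of the extra pair `S8` (directly or through the conjugate class). -/
theorem zw_L4 {n x : ℕ} (h1 : 23 * n < 2 * p) (h2 : p ≤ 12 * n) (hp2 : p % 2 = 1) (hx : x < p)
    (hL : x + 4 * p ≤ 51 * n) (hL' : 51 * n < x + 4 * p + p) :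
    (-8 : ℤ) ≤ classExp (bRay β5 n) p x ∧
    (classExp (bRay β5 n) p x = -8 → ¬ CentreIn (bRay β5 n) p x ∧ classTypeList (bRay β5 n) p x ∈ D8) ∧
    (classExp (bRay β5 n) p x = -7 →
      (¬ CentreIn (bRay β5 n) p x ∧ classTypeList (bRay β5 n) p x ∈ S8) ∨
      (¬ (2 : ℤ) ∣ (bRay β5 n) 0 ∧ CentreIn (bRay β5 n) p x ∧ classTypeList (bRay β5 n) p x ∈ Pc8)) := by
  have hE' := Ray5Z13.classExp_L4 (p := p) (n := n) (x := x) hx hL hL'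
  have hT := centreTerm_spec (bRay β5 n) p x
  generalize hcT : (if ¬ (2 : ℤ) ∣ (bRay β5 n) 0 ∧ CentreIn (bRay β5 n) p x then (1 : ℤ) else 0) = cT at hE' hT
  have h0 : (0 : ℤ) ≤ (bRay β5 n) 0 := by rw [ray5_zero]; positivity
  have hL1 : x + 4 * p ≤ ((bRay β5 n) 0).toNat := by rw [b0_toNat]; exact hL
  have hL2 : ((bRay β5 n) 0).toNat < x + 4 * p + p := by rw [b0_toNat]; exact hL'
  have hcen : CentreIn (bRay β5 n) p x ↔ 2 * x + 4 * p = 51 * n := by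
    rw [centreIn_iff_last (bRay β5 n) (L := 4) hx hL1 hL2 h0, b0_toNat]
  have hb0 : (bRay β5 n) 0 = ((51 * n : ℕ) : ℤ) := ray5_zero n
  rw [hcen, hb0] at hT
  have hTL : classTypeList (bRay β5 n) p x = [netExp (bRay β5 n) (x), netExp (bRay β5 n) (x + p), netExp (bRay β5 n) (x + 2 * p),
      netExp (bRay β5 n) (x + 3 * p), netExp (bRay β5 n) (x + 4 * p)] := by
    rw [classTypeList_level (bRay β5 n) hL1 hL2, show List.range (4 + 1) = [0, 1, 2, 3, 4] from rfl]
    simp only [List.map_cons, List.map_nil, zero_mul, add_zero, one_mul]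
  by_cases ht1 : x + p < 13 * n
  · by_cases ht2 : x + p < 12 * n
    · by_cases ht3 : x + 3 * p ≤ 35 * n
      · obtain ⟨c1, c2, c3, c4, c5, c6, c7, c8, e0, e1, e2, e3, e4⟩ :=
          leaf_L4_2 h1 h2 hp2 hx hL hL' ht1 ht2 ht3
        simp only [e0, e1, e2, e3, e4] at hTL
        exact ⟨by omega, fun hE => absurd hE (by omega), fun hE => absurd hE (by omega)⟩
      · obtain ⟨c1, c2, c3, c4, c5, c6, c7, c8, e0, e1, e2, e3, e4⟩ :=
          leaf_L4_1 h1 h2 hp2 hx hL hL' ht1 ht2 ht3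
        simp only [e0, e1, e2, e3, e4] at hTL
        exact ⟨by omega, fun hE => absurd hE (by omega), fun hE => absurd hE (by omega)⟩
    · by_cases ht3 : x + 3 * p ≤ 36 * n
      · obtain ⟨c1, c2, c3, c4, c5, c6, c7, c8, c9, e0, e1, e2, e3, e4⟩ :=
          leaf_L4_4 h1 h2 hp2 hx hL hL' ht1 ht2 ht3
        simp only [e0, e1, e2, e3, e4] at hTL
        exact ⟨by omega, fun hE => absurd hE (by omega), fun hE => absurd hE (by omega)⟩
      · obtain ⟨c1, c2, c3, c4, c5, c6, c7, c8, c9, e0, e1, e2, e3, e4⟩ :=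
          leaf_L4_3 h1 h2 hp2 hx hL hL' ht1 ht2 ht3
        simp only [e0, e1, e2, e3, e4] at hTL
        exact ⟨by omega, fun hE => absurd hE (by omega), fun hE => absurd hE (by omega)⟩
  · by_cases ht2 : x + p < 15 * n
    · by_cases ht3 : x + 3 * p ≤ 38 * n
      · by_cases ht4 : 2 * (x + 2 * p) = 51 * n
        · obtain ⟨c1, c2, c3, c4, c5, c6, c7, e0, e1, e2, e3, e4⟩ :=
            leaf_L4_7 h1 h2 hp2 hx hL hL' ht1 ht2 ht3 ht4
          simp only [e0, e1, e2, e3, e4] at hTL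
          exact ⟨by omega, fun hE => absurd hE (by omega), fun hE => absurd hE (by omega)⟩
        · obtain ⟨c1, c2, c3, c4, c5, c6, c7, c8, c9, e0, e1, e2, e3, e4⟩ :=
            leaf_L4_6 h1 h2 hp2 hx hL hL' ht1 ht2 ht3 ht4
          simp only [e0, e1, e2, e3, e4] at hTL
          exact ⟨by omega, fun hE => absurd hE (by omega), fun hE => absurd hE (by omega)⟩
      · obtain ⟨c1, c2, c3, c4, c5, c6, c7, c8, c9, e0, e1, e2, e3, e4⟩ :=
          leaf_L4_5 h1 h2 hp2 hx hL hL' ht1 ht2 ht3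
        simp only [e0, e1, e2, e3, e4] at hTL
        exact ⟨by omega, fun hE => absurd hE (by omega), fun hE => absurd hE (by omega)⟩
    · by_cases ht3 : x + p < 16 * n
      · by_cases ht4 : x + 3 * p ≤ 39 * n
        · obtain ⟨c1, c2, c3, c4, c5, c6, c7, c8, c9, e0, e1, e2, e3, e4⟩ :=
            leaf_L4_9 h1 h2 hp2 hx hL hL' ht1 ht2 ht3 ht4
          simp only [e0, e1, e2, e3, e4] at hTL
          exact ⟨by omega, fun hE => absurd hE (by omega), fun hE => absurd hE (by omega)⟩
        · obtain ⟨c1, c2, c3, c4, c5, c6, c7, c8, e0, e1, e2, e3, e4⟩ :=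
            leaf_L4_8 h1 h2 hp2 hx hL hL' ht1 ht2 ht3 ht4
          simp only [e0, e1, e2, e3, e4] at hTL
          exact ⟨by omega, fun hE => absurd hE (by omega), fun hE => absurd hE (by omega)⟩
      · obtain ⟨c1, c2, c3, c4, c5, c6, c7, c8, e0, e1, e2, e3, e4⟩ :=
          leaf_L4_10 h1 h2 hp2 hx hL hL' ht1 ht2 ht3
        simp only [e0, e1, e2, e3, e4] at hTL
        exact ⟨by omega, fun hE => absurd hE (by omega), fun hE => absurd hE (by omega)⟩

/-- **`T1Rays.Ray5OriginClassesO12` IS A THEOREM**: the class structure `OriginWindowClasses (bRay β5 n) p 8 D8 S8 Pc8` of the origin window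
`M = 8` (`23 * n < 2 * p`, `p ≤ 12 * n`) of the T1-map ray `bRay β5 n`, for every `n ≥ 2` and every (odd) prime of the window. -/
theorem ray5OriginClassesO12_holds : Ray5OriginClassesO12 := by
  intro n p hn hprime h1 h2
  haveI : Fact p.Prime := ⟨hprime⟩
  have hp2 : p % 2 = 1 := Nat.odd_iff.1 (hprime.odd_of_ne_two (by omega))
  unfold OriginWindowClasses
  refine ⟨fun x hx _ => ?_, fun x hx _ hE => ?_, fun x hx _ hE => ?_⟩
  · rcases Nat.lt_or_ge (51 * n) (x + 4 * p) with hL4 | hL4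
    · have h := (zw_L3 h1 h2 hp2 hx (by omega) (by omega)).1
      omega
    · have h := (zw_L4 h1 h2 hp2 hx (by omega) (by omega)).1
      omega
  · rcases Nat.lt_or_ge (51 * n) (x + 4 * p) with hL4 | hL4
    · exact (zw_L3 h1 h2 hp2 hx (by omega) (by omega)).2.1 (by omega)
    · exact (zw_L4 h1 h2 hp2 hx (by omega) (by omega)).2.1 (by omega)
  · rcases Nat.lt_or_ge (51 * n) (x + 4 * p) with hL4 | hL4
    · exact (zw_L3 h1 h2 hp2 hx (by omega) (by omega)).2.2 (by omega)
    · exact (zw_L4 h1 h2 hp2 hx (by omega) (by omega)).2.2 (by omega)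

/-- **`T1Rays.Ray5WindowO12` IS A THEOREM**: `v_p(Cas₇(b(n))) ≥ -11` at every prime of the origin window `M = 8`
(`23 * n < 2 * p`, `p ≤ 12 * n`) of the ray `bRay β5 n`, `n ≥ 2` — UNCONDITIONAL: gen-2 g16's PROVED reduction
`T1Rays.ray5WindowO12_of` (class structure + the line data PROVED there (`lineData8c`) + the ORIGIN type-space law `typeSpaceLawOrigin_holds`)
applied to `ray5OriginClassesO12_holds`. -/
theorem ray5WindowO12_holds : Ray5WindowO12 := ray5WindowO12_of ray5OriginClassesO12_holds

end Summit.KontsevichZagierPeriods.Zeta5Search.Ray5O12
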